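import Literature.Analysis.FluidPDE.TypeIAncientMild
import Literature.Analysis.FluidPDE.KNSSMildDecayHorizontal
import Literature.Analysis.FluidPDE.MildSolutionProofs
import HarnessLib

/-!
# Stub T1 of line `blowdown-kills-pitch` of crux `SymmetricLiouville`: the ancient Oseen inequality

Crux stmt-NavierStokesRegularity-4053, route `SymmetryModuliCount`.

For every element `u` of the Type-I moduli class `A_C = IsTypeIAncientMild C` (smooth, divergence
free, KNSS/Oseen-mild between all pairs `s < t < 0`, `‖u(t,x)‖ ≤ C/√(−t)`; NO symmetry), every
`t < 0` and every `x ∈ ℝ³`,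

  `‖u(t,x)‖ ≤ C₀ ∫_{τ<t} ∫_{ℝ³} (t − τ + ‖x − y‖²)^{-2} ‖u(τ,y)‖² dy dτ`,

stated in `ℝ≥0∞` (so no integrability is asserted), where `C₀` is the constant of the
Koch–Tataru / KNSS (3.8) kernel bound `‖K(σ,z)[a,b]‖ ≤ C₀ (σ + ‖z‖²)^{-2} ‖a‖ ‖b‖`
(`exists_norm_oseenKernel_three_le`).

Proof. In the Oseen identity `u(t) = e^{(t−s)Δ}u(s) − ∫_{(s,t)}∫ K(t−τ, x−y)[u(τ,y), u(τ,y)]`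
(`IsTypeIAncientMild.mild_eq_oseenKernel`, any `s < t`) the free term is `≤ C/√(−s)` (maximum
principle `norm_heatFlow_le` with the Type-I bound at time `s`), the Duhamel term is bounded
through `‖∫∫K‖ₑ ≤ ∫⁻∫⁻‖K‖ₑ` (`enorm_integral_le_lintegral_enorm` twice) and the kernel bound,
and the resulting lintegral over `τ ∈ (s,t)` is at most the one over `τ < t`
(`ofReal_norm_le_add_oseenLintegral`). Letting `s → −∞` kills the free term
(`ENNReal.le_of_forall_pos_le_add` with `s = t − (C/ε)² − 1`).
-/

noncomputable section

-- the tree namespace `Summit.NavierStokesRegularity.NavierStokesRegularity.…` repeats a component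
set_option linter.dupNamespace false

open Set Function Filter MeasureTheory
open scoped Topology ENNReal NNReal
open Literature.Analysis Literature.Analysis.FluidPDE

namespace Summit.NavierStokesRegularity.NavierStokesRegularity.Theorems.SymmetryModuliCountSymmetricLiouville

/-- Local notation for physical space `ℝ³`. -/
local notation "E3" => EuclideanSpace ℝ (Fin 3)

/-- **The Oseen identity at finite initial time, in `ℝ≥0∞`.** Given the kernel bound
`‖K(σ,z)[a,b]‖ ≤ C₀ (σ + ‖z‖²)^{-2} ‖a‖ ‖b‖` (`σ > 0`), for `u ∈ A_C`, `s < t < 0` and `x ∈ ℝ³`: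
`ofReal ‖u(t,x)‖ ≤ ofReal (C/√(−s)) + ofReal C₀ · ∫⁻_{τ<t} ∫⁻ ofReal ((t−τ+‖x−y‖²)^{-2}‖u(τ,y)‖²)`
— the free term `e^{(t−s)Δ}u(s)` is bounded by the maximum principle and `‖u(s,·)‖ ≤ C/√(−s)`,
the Duhamel term by `‖∫∫K‖ₑ ≤ ∫⁻∫⁻‖K‖ₑ`, the kernel bound, and monotonicity of the lintegral in
the domain `(s,t) ⊆ (−∞,t)`. -/
theorem ofReal_norm_le_add_oseenLintegral {C₀ : ℝ} (hC₀ : 0 < C₀)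
    (hK : ∀ ⦃σ : ℝ⦄, 0 < σ → ∀ z a b : E3,
      ‖oseenKernel σ z a b‖ ≤ C₀ * (σ + ‖z‖ ^ 2) ^ (-(2 : ℝ)) * ‖a‖ * ‖b‖)
    {C : ℝ} {u : ℝ → E3 → E3} (hu : IsTypeIAncientMild C u) {s t : ℝ} (hst : s < t) (ht : t < 0)
    (x : E3) :
    ENNReal.ofReal ‖u t x‖ ≤ ENNReal.ofReal (C / Real.sqrt (-s)) + ENNReal.ofReal C₀ *
      ∫⁻ τ in Iio t, ∫⁻ y, ENNReal.ofReal ((t - τ + ‖x - y‖ ^ 2)⁻¹ ^ 2 * ‖u τ y‖ ^ 2) := by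
  set F : ℝ → E3 → ℝ≥0∞ := fun τ y =>
    ENNReal.ofReal ((t - τ + ‖x - y‖ ^ 2)⁻¹ ^ 2 * ‖u τ y‖ ^ 2) with hF
  set K : ℝ → E3 → E3 := fun τ y => oseenKernel (t - τ) (x - y) (u τ y) (u τ y) with hKdef
  have hs : s < 0 := hst.trans ht
  -- pointwise kernel bound on the slab `τ ∈ (s, t)`
  have hpt : ∀ τ ∈ Ioo s t, ∀ y, ‖K τ y‖ₑ ≤ ENNReal.ofReal C₀ * F τ y := by
    intro τ hτ y
    have hσ : 0 < t - τ := sub_pos.2 hτ.2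
    have ha : 0 ≤ t - τ + ‖x - y‖ ^ 2 := by positivity
    rw [← ofReal_norm, hF, ← ENNReal.ofReal_mul hC₀.le]
    refine ENNReal.ofReal_le_ofReal ?_
    calc ‖K τ y‖ ≤ C₀ * (t - τ + ‖x - y‖ ^ 2) ^ (-(2 : ℝ)) * ‖u τ y‖ * ‖u τ y‖ := hK hσ _ _ _
      _ = C₀ * ((t - τ + ‖x - y‖ ^ 2)⁻¹ ^ 2 * ‖u τ y‖ ^ 2) := by
          rw [Real.rpow_neg ha, Real.rpow_two, ← inv_pow]; ring
  -- the free term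
  have hfree : ‖heatFlow (u s) (t - s) x‖ₑ ≤ ENNReal.ofReal (C / Real.sqrt (-s)) := by
    rw [← ofReal_norm]
    exact ENNReal.ofReal_le_ofReal (norm_heatFlow_le (fun z => hu.norm_le hs z) _ _)
  -- the Duhamel term
  have hduh : ‖∫ τ in Ioo s t, ∫ y, K τ y‖ₑ ≤ ENNReal.ofReal C₀ * ∫⁻ τ in Iio t, ∫⁻ y, F τ y :=
    calc ‖∫ τ in Ioo s t, ∫ y, K τ y‖ₑ ≤ ∫⁻ τ in Ioo s t, ‖∫ y, K τ y‖ₑ :=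
          enorm_integral_le_lintegral_enorm _
      _ ≤ ∫⁻ τ in Ioo s t, ∫⁻ y, ‖K τ y‖ₑ :=
          lintegral_mono fun τ => enorm_integral_le_lintegral_enorm _
      _ ≤ ∫⁻ τ in Ioo s t, ∫⁻ y, ENNReal.ofReal C₀ * F τ y :=
          setLIntegral_mono' measurableSet_Ioo fun τ hτ => lintegral_mono fun y => hpt τ hτ y
      _ = ENNReal.ofReal C₀ * ∫⁻ τ in Ioo s t, ∫⁻ y, F τ y := by
          rw [← lintegral_const_mul' _ _ ENNReal.ofReal_ne_top]
          exact lintegral_congr fun τ => lintegral_const_mul' _ _ ENNReal.ofReal_ne_top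
      _ ≤ ENNReal.ofReal C₀ * ∫⁻ τ in Iio t, ∫⁻ y, F τ y :=
          mul_le_mul_right (lintegral_mono_set Ioo_subset_Iio_self) _
  -- assemble
  calc ENNReal.ofReal ‖u t x‖
      = ‖heatFlow (u s) (t - s) x - ∫ τ in Ioo s t, ∫ y, K τ y‖ₑ := by
        rw [ofReal_norm, hu.mild_eq_oseenKernel hst ht x]
    _ ≤ ‖heatFlow (u s) (t - s) x‖ₑ + ‖∫ τ in Ioo s t, ∫ y, K τ y‖ₑ := enorm_sub_le
    _ ≤ _ := add_le_add hfree hduh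

/-- **Stub T1 — the ancient Oseen inequality.** There is `C₀ > 0` (the constant of the kernel
bound `exists_norm_oseenKernel_three_le`, KNSS 2009 (3.8) in dimension three) such that for every
`u ∈ A_C = IsTypeIAncientMild C u`, every `t < 0` and every `x ∈ ℝ³`,
`‖u(t,x)‖ ≤ C₀ ∫_{τ<t}∫_{ℝ³} (t−τ+‖x−y‖²)^{-2}‖u(τ,y)‖² dy dτ` in `ℝ≥0∞`: by
`ofReal_norm_le_add_oseenLintegral`, `ofReal ‖u(t,x)‖ ≤ ofReal (C/√(−s)) + C₀·I` for every
`s < t`, and `C/√(−s) ≤ ε` for `s = t − (C/ε)² − 1`. -/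
theorem stub_ancientOseenBound :
    ∃ C₀ : ℝ, 0 < C₀ ∧ ∀ (C : ℝ) (u : ℝ → E3 → E3), IsTypeIAncientMild C u → ∀ t < 0, ∀ x : E3,
      ENNReal.ofReal ‖u t x‖ ≤ ENNReal.ofReal C₀ *
        ∫⁻ τ in Set.Iio t, ∫⁻ y, ENNReal.ofReal ((t - τ + ‖x - y‖ ^ 2)⁻¹ ^ 2 * ‖u τ y‖ ^ 2) := by
  obtain ⟨C₀, hC₀, hK⟩ := exists_norm_oseenKernel_three_le
  refine ⟨C₀, hC₀, fun C u hu t ht x => ?_⟩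
  refine ENNReal.le_of_forall_pos_le_add fun ε hε _ => ?_
  have hε' : (0 : ℝ) < ε := NNReal.coe_pos.2 hε
  -- an initial time `s < t` with `C/√(-s) ≤ ε`
  set s : ℝ := t - ((C / ε) ^ 2 + 1) with hs
  have hst : s < t := by rw [hs]; nlinarith [sq_nonneg (C / ε)]
  have hCε : C / Real.sqrt (-s) ≤ ε := by
    have hsqrt : C / ε ≤ Real.sqrt (-s) :=
      Real.le_sqrt_of_sq_le (by rw [hs]; nlinarith [sq_nonneg (C / ε)])
    have hpos : 0 < Real.sqrt (-s) := Real.sqrt_pos.2 (by linarith)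
    rw [div_le_iff₀ hpos]
    calc C = ε * (C / ε) := by field_simp
      _ ≤ ε * Real.sqrt (-s) := mul_le_mul_of_nonneg_left hsqrt hε'.le
  calc ENNReal.ofReal ‖u t x‖
      ≤ ENNReal.ofReal (C / Real.sqrt (-s)) + ENNReal.ofReal C₀ *
          ∫⁻ τ in Iio t, ∫⁻ y, ENNReal.ofReal ((t - τ + ‖x - y‖ ^ 2)⁻¹ ^ 2 * ‖u τ y‖ ^ 2) :=
        ofReal_norm_le_add_oseenLintegral hC₀ hK hu hst ht x
    _ ≤ ENNReal.ofReal C₀ *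
          (∫⁻ τ in Iio t, ∫⁻ y, ENNReal.ofReal ((t - τ + ‖x - y‖ ^ 2)⁻¹ ^ 2 * ‖u τ y‖ ^ 2)) +
          ε := by
        rw [add_comm]
        gcongr
        rw [← ENNReal.ofReal_coe_nnreal]
        exact ENNReal.ofReal_le_ofReal hCε

end Summit.NavierStokesRegularity.NavierStokesRegularity.Theorems.SymmetryModuliCountSymmetricLiouville

end
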